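import Literature.RingTheory.MvPowerSeries.MonoidPowerSeriesLift
import Literature.RingTheory.MvPowerSeries.MonoidPowerSeriesDivision
import Literature.RingTheory.MvPowerSeries.MonoidPowerSeriesDimension
import Literature.AlgebraicGeometry.Resolution.NodalBlowupFormalChartsCodimTwo
import Literature.AlgebraicGeometry.Resolution.RegularLocalRingsQuotient
import Literature.RingTheory.KrullDimension.AffineDimension
import Literature.NumberTheory.GaloisRepresentations.NearlyOrdinaryPresentationProofs
import HarnessLib

/-!
# Kato's structure theorem for complete log regular local rings (Toric singularities, (3.1)–(3.2))

`Literature/AlgebraicGeometry/Resolution/LogRegularCompleteStructure.lean`. K. Kato, *Toric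
singularities*, Amer. J. Math. 116 (1994), Thm. (3.1)/(3.2): if `(X, M)` is log regular at `x`
and `P → 𝒪_{X,x}` is a chart by a sharp fs monoid, then (1) if `𝒪_{X,x}` contains a field,
`k[[P]][[T₁,…,T_r]] ≅ 𝒪̂_{X,x}`; (2) otherwise, for a complete DVR `R` with prime element `p`
mapping to `𝒪̂_{X,x}`, the kernel of the surjection `R[[P]][[T₁,…,T_r]] → 𝒪̂_{X,x}` "is
generated by an element `θ` such that `θ ≡ p mod (P ∖ {1}, T₁, …, T_r)`". Kato's proof (3.3):
dimension count (`dim k[[P]][[T]] = dim Pᵍᵖ + r = dim 𝒪`) plus the fact that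
`R[[P]][[T]]/(θ)` is a domain (Lemmas (3.4)–(3.5)).

We PROVE this for a COMPLETE Noetherian local ring `A` in the normal form where the regular
parameters `T_i` have been absorbed into the monoid (replace `P` by `P × ℕ^r`), i.e. for a chart
`φ : P → A` (`P ⊆ ℕ^{(M)}` finitely generated, `φ(P ∖ 0) ⊆ 𝔪_A` generating `𝔪_A`) with
`dim A = rank P` (Kato's condition (2.1) with `𝒪/I(x,M)` a field), and with the coefficient ring
`Λ → A` given (a field, or a complete DVR; their existence is `CoefficientDVR.lean`):

* `exists_lift_surjective` — the surjection `ψ : Λ⟦P⟧ → A` extending `φ` and `Λ → A`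
  (Matsumura 8.4 via the tree's `exists_mvPowerSeries_ringHom_surjective_of_base`, then
  `monoidPowerSeries.lift`);
* `exists_theta` — an element `θ ∈ ker ψ` with constant coefficient the uniformizer `π`;
* `ker_eq_span_theta` — **(3.2) (2)**: if `Λ` is a complete DVR with `𝔪_Λ = (π)`, then
  `ker ψ = (θ)` (so `A ≅ Λ⟦P⟧/(θ)`);
* `ker_eq_bot_of_isField` — **(3.2) (1)**: if `Λ` is a field, `ψ` is an isomorphism
  (`A ≅ Λ⟦P⟧`).

References: [Kato1994] K. Kato, Toric singularities, Amer. J. Math. 116 (1994), (3.1)–(3.5);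
[Matsumura1987] H. Matsumura, Commutative Ring Theory, Thm. 8.4.
-/

noncomputable section

open IsLocalRing MvPowerSeries Literature.RingTheory.MvPowerSeries
  Literature.RingTheory.MvPowerSeries.monoidPowerSeries

namespace Literature.AlgebraicGeometry.Resolution

namespace LogRegularCompleteStructure

universe u

variable {A : Type u} [CommRing A] {Λ : Type u} [CommRing Λ] {M : ℕ} {P : AddSubmonoid (Fin M →₀ ℕ)}

/-! ### Charts: a monoid homomorphism `φ : P → (A, ·)` rendered as a function on exponents -/

/-- Multiplicativity of the chart on `expSum`: `φ (∑ dᵢ gᵢ) = ∏ φ(gᵢ)^{dᵢ}`.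
[cite: Kato1994, (3.2)] -/
theorem map_expSum {ι : Type} (g : ι → (Fin M →₀ ℕ)) (hg : ∀ i, g i ∈ P)
    (φ : (Fin M →₀ ℕ) → A) (hφ0 : φ 0 = 1) (hφadd : ∀ a ∈ P, ∀ b ∈ P, φ (a + b) = φ a * φ b)
    (d : ι →₀ ℕ) : φ (expSum g d) = d.prod fun i n => φ (g i) ^ n := by
  classical
  induction d using Finsupp.induction with
  | zero => rw [expSum_zero, hφ0, Finsupp.prod_zero_index]
  | single_add i n e hi hn ih =>
    rw [expSum_add, expSum_single, hφadd _ (P.nsmul_mem (hg i) n) _ (expSum_mem_closure g e |>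
      fun h => (AddSubmonoid.closure_le.2 (by rintro _ ⟨k, rfl⟩; exact hg k)) h), ih,
      Finsupp.prod_add_index_of_disjoint]
    · have hsingle : ((Finsupp.single i n).prod fun i n => φ (g i) ^ n) = φ (g i) ^ n :=
        Finsupp.prod_single_index (h := fun i n => φ (g i) ^ n) (pow_zero _)
      rw [hsingle]
      -- `φ (n • g i) = φ (g i) ^ n`
      congr 1
      clear hsingle hn
      induction n with
      | zero => rw [zero_smul, hφ0, pow_zero]
      | succ k ihk =>
        rw [succ_nsmul, hφadd _ (P.nsmul_mem (hg i) k) _ (hg i), ihk, pow_succ]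
    · exact Finset.disjoint_of_subset_left Finsupp.support_single_subset
        (Finset.disjoint_singleton_left.2 hi)

/-! ### The surjection `Λ⟦P⟧ → A` -/

/-- **The chart extends to a surjection `ψ : Λ⟦P⟧ → A`** (Kato (3.2): "the surjective
homomorphism `R[[P]][[T]] → 𝒪̂`"; surjectivity is Matsumura 8.4): `A` complete Noetherian local,
`Λ → A` a local homomorphism from a complete local ring inducing a surjection on residue fields,
`φ : P → A` a chart with `φ(P ∖ 0) ⊆ 𝔪_A` whose image generates `𝔪_A`.
[cite: Kato1994, (3.2)] [cite: Matsumura1987, Thm. 8.4] -/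
theorem exists_lift_surjective [IsLocalRing A] [IsNoetherianRing A] [IsAdicComplete (maximalIdeal A) A]
    [IsLocalRing Λ] [IsAdicComplete (maximalIdeal Λ) Λ] (j : Λ →+* A) [IsLocalHom j]
    (hres : ∀ a : A, ∃ l : Λ, a - j l ∈ maximalIdeal A) (hP : P.FG)
    (φ : (Fin M →₀ ℕ) → A) (hφ0 : φ 0 = 1) (hφadd : ∀ a ∈ P, ∀ b ∈ P, φ (a + b) = φ a * φ b)
    (hφm : ∀ p ∈ P, p ≠ 0 → φ p ∈ maximalIdeal A)
    (hgen : maximalIdeal A ≤ Ideal.span (φ '' {p | p ∈ P ∧ p ≠ 0})) :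
    ∃ ψ : monoidPowerSeries Λ P →+* A, Function.Surjective ψ ∧
      (∀ (p : Fin M →₀ ℕ) (hp : p ∈ P), ψ ⟨MvPowerSeries.monomial p (1 : Λ), monomial_mem hp 1⟩ = φ p) ∧
      (∀ l : Λ, ψ ⟨MvPowerSeries.C l, C_mem l⟩ = j l) := by
  classical
  -- non-zero generators of `P`
  obtain ⟨m, g, hg0, hgP⟩ : ∃ (m : ℕ) (g : Fin m → (Fin M →₀ ℕ)), (∀ i, g i ≠ 0) ∧
      AddSubmonoid.closure (Set.range g) = P := by
    obtain ⟨S, hS⟩ := hP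
    let S' := S.filter (· ≠ 0)
    refine ⟨S'.card, fun i => (S'.equivFin.symm i : Fin M →₀ ℕ), fun i => ?_, ?_⟩
    · have h := (S'.equivFin.symm i).2
      simp only [S', Finset.mem_filter] at h
      exact h.2
    · rw [← hS]
      refine le_antisymm (AddSubmonoid.closure_le.2 ?_) (AddSubmonoid.closure_le.2 fun x hx => ?_)
      · rintro _ ⟨i, rfl⟩
        have h := (S'.equivFin.symm i).2
        simp only [S', Finset.mem_filter] at h
        exact AddSubmonoid.subset_closure h.1
      · by_cases hx0 : x = 0
        · rw [hx0]; exact AddSubmonoid.zero_mem _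
        · have hx' : x ∈ S' := by simp only [S', Finset.mem_filter]; exact ⟨hx, hx0⟩
          exact AddSubmonoid.subset_closure ⟨S'.equivFin ⟨x, hx'⟩, by simp⟩
  have hgmem : ∀ i, g i ∈ P := fun i => hgP ▸ AddSubmonoid.subset_closure ⟨i, rfl⟩
  -- the substitution `Θ : Λ⟦X⟧ → A`, `Xᵢ ↦ φ(gᵢ)`
  set x : Fin m → A := fun i => φ (g i) with hx
  have hxm : ∀ i, x i ∈ maximalIdeal A := fun i => hφm _ (hgmem i) (hg0 i)
  have hmonP : ∀ d : Fin m →₀ ℕ, φ (expSum g d) = d.prod fun i n => x i ^ n :=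
    fun d => map_expSum g hgmem φ hφ0 hφadd d
  have hgen' : maximalIdeal A ≤ Ideal.span (Set.range x) ⊔ (maximalIdeal Λ).map j := by
    refine hgen.trans ((Ideal.span_le.2 ?_).trans le_sup_left)
    rintro _ ⟨p, ⟨hpP, hp0⟩, rfl⟩
    obtain ⟨d, rfl⟩ := exists_expSum_eq_of_mem_closure g (show p ∈ _ by rw [hgP]; exact hpP)
    have hd0 : d ≠ 0 := by rintro rfl; exact hp0 (expSum_zero g)
    obtain ⟨i, hi⟩ := Finsupp.support_nonempty_iff.2 hd0
    rw [SetLike.mem_coe, hmonP]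
    have hdvd : x i ∣ d.prod fun i n => x i ^ n := by
      refine (dvd_pow_self (x i) (Finsupp.mem_support_iff.1 hi)).trans ?_
      exact Finset.dvd_prod_of_mem (fun j => x j ^ d j) hi
    exact Ideal.mem_of_dvd _ hdvd (Ideal.subset_span ⟨i, rfl⟩)
  obtain ⟨Θ, hΘX, hΘC, hΘsurj⟩ :=
    exists_mvPowerSeries_ringHom_surjective_of_base j hres x hxm hgen'
  have hΘXm : ∀ i, Θ (MvPowerSeries.X i) ∈ maximalIdeal A := fun i => (hΘX i).symm ▸ hxm i
  -- monomials: `Θ (X^d) = φ (∑ dᵢ gᵢ)`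
  have hmon1 : ∀ d : Fin m →₀ ℕ, MvPowerSeries.monomial d (1 : Λ) =
      d.prod fun i n => (MvPowerSeries.X i : MvPowerSeries (Fin m) Λ) ^ n := by
    intro d
    have h := prod_pow_monomial (R := Λ) (fun i : Fin m => Finsupp.single i 1) d
    have hexp : expSum (fun i : Fin m => Finsupp.single i 1) d = d := by
      unfold expSum
      simp only [Finsupp.smul_single_one]
      exact d.sum_single
    rw [hexp] at h
    rw [← h]
    rfl
  have hΘmon' : ∀ d : Fin m →₀ ℕ, Θ (MvPowerSeries.monomial d (1 : Λ)) = φ (expSum g d) := by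
    intro d
    rw [hmon1, map_finsuppProd, hmonP]
    simp only [map_pow, hΘX]
  have hΘmon : ∀ d d' : Fin m →₀ ℕ, expSum g d = expSum g d' →
      Θ (MvPowerSeries.monomial d (1 : Λ)) = Θ (MvPowerSeries.monomial d' 1) := by
    intro d d' h
    rw [hΘmon', hΘmon', h]
  -- the lift `ψ : Λ⟦P⟧ → A`
  refine ⟨lift g hg0 hgP Θ hΘXm hΘmon, ?_, ?_, ?_⟩
  · intro a
    obtain ⟨F, rfl⟩ := hΘsurj a
    exact ⟨substGeneratorsOnto (R := Λ) g hg0 hgP F, lift_comp_apply g hg0 hgP Θ hΘXm hΘmon F⟩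
  · intro p hp
    obtain ⟨d, rfl⟩ := exists_expSum_eq_of_mem_closure g (show p ∈ _ by rw [hgP]; exact hp)
    exact (lift_monomial g hg0 hgP Θ hΘXm hΘmon d).trans (hΘmon' d)
  · intro l
    rw [lift_C, hΘC]

/-! ### The element `θ` -/

/-- **The relation `θ`.** For a surjection `ψ : Λ⟦P⟧ → A` extending a chart whose image
generates `𝔪_A`, and any `π ∈ Λ` mapping into `𝔪_A`, there is `θ ∈ ker ψ` with constant
coefficient `π` (Kato: "there exists `θ ∈ Ker(ψ)` such that `θ ≡ p mod (P ∖ {1}, T₁, …, T_r)`").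
[cite: Kato1994, (3.3)] -/
theorem exists_theta [IsLocalRing A] (ψ : monoidPowerSeries Λ P →+* A) (hψsurj : Function.Surjective ψ)
    (j : Λ →+* A) (hψC : ∀ l : Λ, ψ ⟨MvPowerSeries.C l, C_mem l⟩ = j l)
    (φ : (Fin M →₀ ℕ) → A)
    (hψmon : ∀ (p : Fin M →₀ ℕ) (hp : p ∈ P),
      ψ ⟨MvPowerSeries.monomial p (1 : Λ), monomial_mem hp 1⟩ = φ p)
    (hgen : maximalIdeal A ≤ Ideal.span (φ '' {p | p ∈ P ∧ p ≠ 0}))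
    (π : Λ) (hπ : j π ∈ maximalIdeal A) :
    ∃ θ : monoidPowerSeries Λ P, ψ θ = 0 ∧
      MvPowerSeries.constantCoeff (θ : MvPowerSeries (Fin M) Λ) = π := by
  classical
  -- every element of `(φ(P ∖ 0))` is `ψ y` with `y` of constant coefficient `0`
  have key : ∀ a ∈ Ideal.span (φ '' {p | p ∈ P ∧ p ≠ 0}), ∃ y : monoidPowerSeries Λ P,
      MvPowerSeries.constantCoeff (y : MvPowerSeries (Fin M) Λ) = 0 ∧ ψ y = a := by
    intro a ha
    induction ha using Submodule.span_induction with
    | mem b hb =>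
      obtain ⟨p, ⟨hpP, hp0⟩, rfl⟩ := hb
      refine ⟨⟨MvPowerSeries.monomial p (1 : Λ), monomial_mem hpP 1⟩, ?_, hψmon p hpP⟩
      rw [Subtype.coe_mk, ← MvPowerSeries.coeff_zero_eq_constantCoeff_apply,
        MvPowerSeries.coeff_monomial, if_neg (Ne.symm hp0)]
    | zero => exact ⟨0, by simp, map_zero ψ⟩
    | add b c _ _ hb hc =>
      obtain ⟨y, hy0, hyb⟩ := hb
      obtain ⟨z, hz0, hzc⟩ := hc
      refine ⟨y + z, ?_, by rw [map_add, hyb, hzc]⟩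
      rw [Subalgebra.coe_add, map_add, hy0, hz0, add_zero]
    | smul r b _ hb =>
      obtain ⟨y, hy0, hyb⟩ := hb
      obtain ⟨s, rfl⟩ := hψsurj r
      refine ⟨s * y, ?_, by rw [map_mul, hyb, smul_eq_mul]⟩
      rw [Subalgebra.coe_mul, map_mul, hy0, mul_zero]
  obtain ⟨y, hy0, hyπ⟩ := key (j π) (hgen hπ)
  refine ⟨⟨MvPowerSeries.C π, C_mem π⟩ - y, ?_, ?_⟩
  · rw [map_sub, hψC, hyπ, sub_self]
  · rw [Subalgebra.coe_sub, map_sub, hy0, sub_zero, Subtype.coe_mk, MvPowerSeries.constantCoeff_C]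

/-! ### The kernel: (3.2) (2), the case of a discrete valuation ring of coefficients -/

/-- In the power series ring over a local ring, an element of `𝔪²` has constant coefficient in
`𝔪_Λ²`. [cite: Kato1994, (3.3)] -/
theorem constantCoeff_mem_sq_of_mem_sq [IsLocalRing Λ] {f : MvPowerSeries (Fin M) Λ}
    (hf : f ∈ maximalIdeal (MvPowerSeries (Fin M) Λ) ^ 2) :
    MvPowerSeries.constantCoeff f ∈ maximalIdeal Λ ^ 2 := by
  have hle : (maximalIdeal (MvPowerSeries (Fin M) Λ)).map
      (MvPowerSeries.constantCoeff : MvPowerSeries (Fin M) Λ →+* Λ) ≤ maximalIdeal Λ := by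
    refine (Ideal.map_le_iff_le_comap).2 fun g hg => ?_
    rw [Ideal.mem_comap, mem_maximalIdeal, mem_nonunits_iff]
    exact fun hu => ((mem_maximalIdeal _).1 hg) (MvPowerSeries.isUnit_iff_constantCoeff.2 hu)
  have h := Ideal.mem_map_of_mem (MvPowerSeries.constantCoeff : MvPowerSeries (Fin M) Λ →+* Λ) hf
  rw [Ideal.map_pow] at h
  exact Ideal.pow_right_mono hle 2 h

/-- A generator `π ≠ 0` of the maximal ideal of a local domain is not in `𝔪²`.
[cite: Kato1994, (3.1)] -/
theorem generator_not_mem_sq [IsLocalRing Λ] [IsDomain Λ] {π : Λ} (hπ0 : π ≠ 0)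
    (hmax : maximalIdeal Λ = Ideal.span {π}) : π ∉ maximalIdeal Λ ^ 2 := by
  intro h
  rw [hmax, Ideal.span_singleton_pow, Ideal.mem_span_singleton] at h
  obtain ⟨c, hc⟩ := h
  have h1 : π * (1 - π * c) = 0 := by rw [mul_sub, mul_one, ← mul_assoc, ← pow_two, ← hc, sub_self]
  rcases mul_eq_zero.1 h1 with h | h
  · exact hπ0 h
  · have hπm : π ∈ maximalIdeal Λ := hmax ▸ Ideal.subset_span rfl
    have hu : IsUnit (1 - π * c) :=
      IsLocalRing.isUnit_one_sub_self_of_mem_nonunits _ (Ideal.mul_mem_right _ _ hπm)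
    exact hu.ne_zero h

/-- Chains of primes: if `J < K` are ideals with `J` prime then `n ≤ dim R/K ⇒ n + 1 ≤ dim R/J`
(prepend `J` to a chain of primes containing `K`). [cite: Kato1994, (3.3)] -/
theorem succ_le_ringKrullDim_quotient_of_lt {R : Type u} [CommRing R] {J K : Ideal R}
    [hJ : J.IsPrime] (hJK : J < K) (n : ℕ) (hK : (n : WithBot ℕ∞) ≤ ringKrullDim (R ⧸ K)) :
    ((n + 1 : ℕ) : WithBot ℕ∞) ≤ ringKrullDim (R ⧸ J) := by
  rw [ringKrullDim_quotient] at hK ⊢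
  obtain ⟨s, hs⟩ := Order.le_krullDim_iff.1 hK
  have hmem : ∀ i : Fin (s.length + 1), (s i).1 ∈ PrimeSpectrum.zeroLocus (R := R) (J : Set R) :=
    fun i => (PrimeSpectrum.zeroLocus_anti_mono hJK.le) (s i).2
  let s' : LTSeries (PrimeSpectrum.zeroLocus (R := R) (J : Set R)) :=
    { length := s.length
      toFun := fun i => ⟨(s i).1, hmem i⟩
      step := fun i => s.step i }
  let x : PrimeSpectrum.zeroLocus (R := R) (J : Set R) :=
    ⟨⟨J, hJ⟩, (PrimeSpectrum.mem_zeroLocus _ _).2 le_rfl⟩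
  have hx : x < s'.head := by
    have h0 : K ≤ (s 0).1.asIdeal := (PrimeSpectrum.mem_zeroLocus _ _).1 (s 0).2
    change (⟨J, hJ⟩ : PrimeSpectrum R) < (s 0).1
    rw [← PrimeSpectrum.asIdeal_lt_asIdeal]
    exact lt_of_lt_of_le hJK h0
  have h := Order.LTSeries.length_le_krullDim (s'.cons x hx)
  rw [RelSeries.cons_length] at h
  rw [← hs]
  exact_mod_cast h

/-- **Kato 1994, Thm. (3.2) (2) / (3.1) (1)** (d = 0 normal form): let `A` be a complete
Noetherian local ring, `Λ` a complete discrete valuation ring with uniformizer `π` (a complete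
Noetherian local domain with `𝔪_Λ = (π)`, `π ≠ 0`), `ψ : Λ⟦P⟧ → A` a surjection and
`θ ∈ ker ψ` with constant coefficient `π`. If `dim A = rank P` then `ker ψ = (θ)`, i.e.
`A ≅ Λ⟦P⟧/(θ)`. (Dimension count: `Λ⟦P⟧/(θ)` is a domain — it embeds into the regular local
ring `Λ⟦T₁,…,T_M⟧/(θ)` by Lemma (3.5) — of dimension `≤ rank P = dim A`.)
[cite: Kato1994, (3.1)–(3.3)] -/
theorem ker_eq_span_theta [IsLocalRing Λ] [IsDomain Λ] [IsNoetherianRing Λ] {π : Λ} (hπ0 : π ≠ 0)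
    (hmax : maximalIdeal Λ = Ideal.span {π}) (hP : P.FG)
    (ψ : monoidPowerSeries Λ P →+* A) (hψsurj : Function.Surjective ψ)
    (hdim : ringKrullDim A = rank P) (θ : monoidPowerSeries Λ P) (hθ : ψ θ = 0)
    (hθπ : MvPowerSeries.constantCoeff (θ : MvPowerSeries (Fin M) Λ) = π) :
    RingHom.ker ψ = Ideal.span {θ} := by
  classical
  -- `Λ` is a DVR
  have hnf : ¬IsField Λ := by
    rw [IsLocalRing.isField_iff_maximalIdeal_eq, hmax, Ideal.span_singleton_eq_bot]
    exact hπ0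
  have hprinc : (maximalIdeal Λ).IsPrincipal := ⟨⟨π, hmax⟩⟩
  haveI : IsDiscreteValuationRing Λ := ((IsDiscreteValuationRing.TFAE Λ hnf).out 0 4).mpr hprinc
  -- the ambient power series ring `E := Λ⟦T₁,…,T_M⟧` and `E/(θ)`
  haveI hEreg0 : IsRegularLocalRing (MvPowerSeries (Fin M) Λ) :=
    Literature.NumberTheory.GaloisRepresentations.NearlyOrdinaryPresentationCA.isRegularLocalRing_mvPowerSeries_dvr
      Λ M
  haveI : IsDomain (MvPowerSeries (Fin M) Λ) := isDomain_of_isRegularLocalRing _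
  haveI : IsDomain (monoidPowerSeries Λ P) :=
    Function.Injective.isDomain (monoidPowerSeries Λ P).val.toRingHom Subtype.val_injective
  have hπm : π ∈ maximalIdeal Λ := hmax ▸ Ideal.subset_span rfl
  have hθm : (θ : MvPowerSeries (Fin M) Λ) ∈ maximalIdeal (MvPowerSeries (Fin M) Λ) := by
    rw [mem_maximalIdeal, mem_nonunits_iff]
    intro hu
    have h := MvPowerSeries.isUnit_constantCoeff _ hu
    rw [hθπ] at h
    exact ((mem_maximalIdeal _).1 hπm) h
  have hθ2 : (θ : MvPowerSeries (Fin M) Λ) ∉ maximalIdeal (MvPowerSeries (Fin M) Λ) ^ 2 :=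
    fun h => generator_not_mem_sq hπ0 hmax (hθπ ▸ constantCoeff_mem_sq_of_mem_sq h)
  haveI : IsRegularLocalRing (MvPowerSeries (Fin M) Λ ⧸
      Ideal.span {(θ : MvPowerSeries (Fin M) Λ)}) :=
    (IsRegularLocalRing.quotient_span_singleton hθm hθ2).1
  haveI : IsDomain (MvPowerSeries (Fin M) Λ ⧸ Ideal.span {(θ : MvPowerSeries (Fin M) Λ)}) :=
    isDomain_of_isRegularLocalRing _
  -- `Λ⟦P⟧/(θ)` is a domain (Lemma 3.5)
  have hπnzd : MvPowerSeries.constantCoeff (θ : MvPowerSeries (Fin M) Λ) ∈ nonZeroDivisors Λ := by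
    rw [hθπ]; exact mem_nonZeroDivisors_of_ne_zero hπ0
  have hle : Ideal.span {θ} ≤ (Ideal.span {(θ : MvPowerSeries (Fin M) Λ)}).comap
      (monoidPowerSeries Λ P).val.toRingHom := by
    rw [Ideal.span_le, Set.singleton_subset_iff]
    exact Ideal.mem_comap.2 (Ideal.subset_span rfl)
  haveI : IsDomain (monoidPowerSeries Λ P ⧸ Ideal.span {θ}) :=
    Function.Injective.isDomain _ (quotientMap_injective θ hπnzd hle)
  -- dimensions
  haveI : IsNoetherianRing (monoidPowerSeries Λ P) := monoidPowerSeries.isNoetherianRing hP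
  haveI : IsLocalRing (monoidPowerSeries Λ P) := monoidPowerSeries.isLocalRing
  have hθ0 : θ ≠ 0 := by
    intro h
    apply hπ0
    rw [← hθπ, h, Subalgebra.coe_zero, map_zero]
  have hdimD : ringKrullDim (monoidPowerSeries Λ P) ≤ 1 + (rank P : WithBot ℕ∞) := by
    have h := monoidPowerSeries.ringKrullDim_le (R := Λ) hP
    rwa [IsDiscreteValuationRing.ringKrullDim_eq_one Λ] at h
  have hdimDθ : ringKrullDim (monoidPowerSeries Λ P ⧸ Ideal.span {θ}) + 1 ≤
      1 + (rank P : WithBot ℕ∞) :=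
    (Literature.RingTheory.KrullDimension.ringKrullDim_quotient_add_one_le
      (show Ideal.span {θ} ≠ ⊥ by rw [Ne, Ideal.span_singleton_eq_bot]; exact hθ0)).trans hdimD
  -- `span {θ} ≤ ker ψ`, and equality by a dimension count on chains of primes
  have hJK : Ideal.span {θ} ≤ RingHom.ker ψ := by
    rw [Ideal.span_le, Set.singleton_subset_iff]
    exact hθ
  by_contra hne
  have hlt : Ideal.span {θ} < RingHom.ker ψ := lt_of_le_of_ne hJK (Ne.symm hne)
  haveI : (Ideal.span {θ} : Ideal (monoidPowerSeries Λ P)).IsPrime :=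
    (Ideal.Quotient.isDomain_iff_prime _).1 inferInstance
  have hdimK : ((rank P : ℕ) : WithBot ℕ∞) ≤ ringKrullDim (monoidPowerSeries Λ P ⧸ RingHom.ker ψ) := by
    rw [ringKrullDim_eq_of_ringEquiv (RingHom.quotientKerEquivOfSurjective hψsurj), hdim]
  have h1 := succ_le_ringKrullDim_quotient_of_lt hlt (rank P) hdimK
  have h2 : ((rank P + 1 : ℕ) : WithBot ℕ∞) + 1 ≤ 1 + (rank P : WithBot ℕ∞) :=
    (add_le_add h1 le_rfl).trans hdimDθ
  have h3 : rank P + 1 + 1 ≤ 1 + rank P := by exact_mod_cast h2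
  omega

/-! ### The kernel: (3.2) (1), the case of a coefficient field -/

/-- **Kato 1994, Thm. (3.2) (1)** (d = 0 normal form): for a complete Noetherian local ring `A`,
a FIELD of coefficients `K` and a surjection `ψ : K⟦P⟧ → A` with `dim A = rank P`, `ψ` is an
isomorphism: `A ≅ K⟦P⟧`. [cite: Kato1994, (3.1)–(3.3)] -/
theorem ker_eq_bot_of_field {K : Type u} [Field K] (hP : P.FG)
    (ψ : monoidPowerSeries K P →+* A) (hψsurj : Function.Surjective ψ)
    (hdim : ringKrullDim A = rank P) : RingHom.ker ψ = ⊥ := by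
  classical
  haveI : IsNoetherianRing (monoidPowerSeries K P) := monoidPowerSeries.isNoetherianRing hP
  haveI : IsLocalRing (monoidPowerSeries K P) := monoidPowerSeries.isLocalRing
  haveI : IsDomain (MvPowerSeries (Fin M) K) := NoZeroDivisors.to_isDomain _
  haveI : IsDomain (monoidPowerSeries K P) :=
    Function.Injective.isDomain (monoidPowerSeries K P).val.toRingHom Subtype.val_injective
  have hdimD : ringKrullDim (monoidPowerSeries K P) ≤ (rank P : WithBot ℕ∞) := by
    have h := monoidPowerSeries.ringKrullDim_le (R := K) hP
    rwa [ringKrullDim_eq_zero_of_isField (Field.toIsField K), zero_add] at h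
  by_contra hne
  have h1 := Literature.RingTheory.KrullDimension.ringKrullDim_quotient_add_one_le
    (A := monoidPowerSeries K P) hne
  rw [ringKrullDim_eq_of_ringEquiv (RingHom.quotientKerEquivOfSurjective hψsurj), hdim] at h1
  have h2 : (rank P : WithBot ℕ∞) + 1 ≤ (rank P : WithBot ℕ∞) := h1.trans hdimD
  have h3 : rank P + 1 ≤ rank P := by exact_mod_cast h2
  omega

end LogRegularCompleteStructure

end Literature.AlgebraicGeometry.Resolution
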